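import Literature.MathematicalPhysics.QuantumLattice.HubbardTTPrimeMeanEnergySupergradient
import Literature.MathematicalPhysics.QuantumLattice.HubbardTTPrimeHartreeFockCeiling
import HarnessLib

/-!
# Program-free ("Tier-1") rows: LP weak duality over an energy CAP and finitely many anchor CUTS
# bounds every linear combination of the three `t–t'–U` energy coordinates of a state

Family `hubbard` (topic `MathematicalPhysics/QuantumLattice`; companion of
`HubbardTTPrimeMeanEnergySupergradient` and `TorusLimitOfMixtures`). Written for the certified fast layer
of the Hubbard re-charter (crew hubbard-fast: engine diagnostic "cuts-limited edges are PROGRAM-FREE"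
2026-08-25, planner-p2 "Tier-1 arithmetic with the LP dual as certificate"): the cheapest certified
observable rows use NO moment relaxation at all, only the certified energy table. Everything is PROVED;
no definition, no named fact, no numerical input.

Coordinates. For an infinite-volume state `ω` of lattice fermions on `ℤ²` write
`K₁(ω) = e_{Φ(1,0,0)}(ω)`, `K₂(ω) = e_{Φ(0,1,0)}(ω)`, `D(ω) = e_{Φ(0,0,1)}(ω)` for the mean energies per site
of the unit nearest-neighbour hopping, the unit diagonal hopping and the unit on-site interaction
(`Φ(t,t',U) = hubbardTTPrimeFermionInteraction t t' U`; for torus limits `D(ω) = Re ω(n_{0↑}n_{0↓})`,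
`IsTorusLimitOf.meanEnergy_onSite_eq_re_expect_docc`). The mean energy is LINEAR in the couplings
(`meanEnergy_hubbardTTPrime_add/_smul`), so

  `e_{Φ(t,t',U)}(ω) = t·K₁(ω) + t'·K₂(ω) + U·D(ω)`     (`meanEnergy_hubbardTTPrime_eq_coords`).

The LP. Suppose `ω` satisfies a CAP `e_{Φ(t,t',U)}(ω) ≤ u` (for a torus-limit ground state at `(t,t',U)`
this is a certified upper bound `e(t,t',U,n) ≤ u`, since `e_Φ(ω) = e(t,t',U,n)`) and CUTS
`ℓ_k ≤ e_{Φ(t,t'_k,U_k)}(ω)`, `k ∈ A` (for torus limits of unit `rectN n`-vectors — ground states or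
Gibbs mixtures alike — every certified lower bound `ℓ_k ≤ e(t,t'_k,U_k,n)` at an anchor with `U_k ≥ 0`
is such a cut, by the variational inequality `e(t,t'_k,U_k,n) ≤ e_{Φ(t,t'_k,U_k)}(ω)`,
`IsTorusLimitOf[Mixture].energyDensityTT'_le_meanEnergy_hubbardTTPrime`). Then `(K₁,K₂,D)(ω)` lies in
the polyhedron `{x : a·x ≤ u, a_k·x ≥ ℓ_k}` with `a = (t,t',U)`, `a_k = (t,t'_k,U_k)`, and LP weak duality
(Bertsekas, *Nonlinear Programming*, Prop. 5.1.3: for multipliers `κ ≥ 0`, `λ_k ≥ 0`,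
`(κa − Σ_k λ_k a_k)·x ≤ κu − Σ_k λ_k ℓ_k` on the polyhedron) gives, for EVERY `κ ≥ 0` and `λ_k ≥ 0`,

  `(κt − Σ_k λ_k t)·K₁(ω) + (κt' − Σ_k λ_k t'_k)·K₂(ω) + (κU − Σ_k λ_k U_k)·D(ω) ≤ κu − Σ_k λ_k ℓ_k`
  (`capCuts_dual_le`, every state; `IsTorusLimitOf.capCuts_dual_le_of_groundState`, torus-limit ground
  states, with `D = Re ω(n_{0↑}n_{0↓})` and the cap / cuts fed from the certified energy table).

Choosing `(κ, λ)` with `κa − Σ λ_k a_k = c` bounds the target functional `c·(K₁,K₂,D)` — e.g. the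
`U`-chord `D ≤ (u − ℓ_k)/(U − U_k)` (`κ = λ_k = 1/(U−U_k)`, `t'_k = t'`, `U_k < U`; the `t' ≠ 0` twin of
`energyDensity2D_le_of_forall_isTorusLimitOf_docc_le`), the kinetic chord `−tK₁ ≤ u − 2ℓ_k` at `U_k = U/2`,
`t'_k = t'/2`… (the crew's "docc_max / hop1_max / hop2_min cuts-limited edges"). The bound is valid at the
state's own coupling only through the cap; it is "program-free": no positivity of any moment matrix is
used, and it improves only by adding anchors or tightening the table.

§4 adds the zero-cost TRANSPORT rule along a `U`-ray ("T-mono"): for two torus-limit ground states at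
`(t,t',U_A)` and `(t,t',U_P)`, `0 ≤ U_A < U_P`, same density, the two cross variational inequalities give
`D(ωP) ≤ D(ωA)` and `e_{Φ(t,t',0)}(ωA) ≤ e_{Φ(t,t',0)}(ωP)` (`docc_le_and_oneBody_le_of_cross_variational`,
every pair of states; `IsTorusLimitOf.docc_le_and_oneBody_le_of_groundStates`) — the monotonicity of the
conjugate observable (Koma–Tasaki §1, Griffiths 1966 §II) without derivatives or uniqueness.

§5 adds the universal docc CEILING of a repulsive ground state: the one-cut `U`-chord between the free
point `U₀ = 0` (cut value `e(t,t',0,n)` itself) and the Hartree–Fock cap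
`e(t,t',U,n) ≤ e(t,t',0,n) + U(n/2)²` (`TTPrimeFree.energyDensityTT'_le_free_add_interaction`,
Bach–Lieb–Solovej (2c.36)) gives `Re ω(n_{0↑}n_{0↓}) ≤ (n/2)²` for every torus-limit ground state at
`U > 0` (`IsTorusLimitOf.re_expect_docc_le_sq_half_density_of_groundState`; the free, uncorrelated value is
never exceeded — the `t–t'` thermodynamic-limit twin of `energyDensityTT'_ge_sub_mul_sq_U`).

§6 (planner-p1 RULING R-9 / L-7, statements and proofs verbatim from the crew's checked sketch
`DirectionalRow.lean`) generalises §4 to an ARBITRARY direction of the `(t', U)` plane: for two states with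
the two cross energy inequalities at `(t, t'_A, U_A)` and `(t, t'_P, U_P)`,
`(U_P − U_A)·(D(ωP) − D(ωA)) + (t'_P − t'_A)·(A(ωP) − A(ωA)) ≤ 0` with `A(ω) = e_{Φ(0,1,0)}(ω)` the unit
diagonal-hopping energy per site (`directional_le_of_cross_variational`; the supergradient map is monotone);
`t'`-axis case `diagHopEnergy_anti_of_cross_variational` (`A` non-increasing in `t'`); torus-limit ground
states `IsTorusLimitOf.directional_le_of_groundStates`, `IsTorusLimitOf.diagHopEnergy_anti_of_groundStates`;
and the full three-coupling form with the `t`-component (`directional3_le_of_cross_variational`,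
`IsTorusLimitOf.directional3_le_of_groundStates`: `(K₁, K₂, D)` is a monotone map of `(t, t', U)`).

§7 (planner-p1 R-9 (c′) / L-8r, verbatim from the crew's checked sketch `DirectionalRow.lean`
sha256 6045279d…, adapted only in that `directional3_le_of_cross_variational` is §6's): the mean energy is
affine in all three couplings (`meanEnergy_hubbardTTPrime_affine3`); the `t`-axis case
`nnHopEnergy_anti_of_cross_variational` (`K₁ = e_{Φ(1,0,0)}` non-increasing in `t` at fixed `(t', U)`); and,
by rescaling on the mean-energy side (`meanEnergy_hubbardTTPrime_smul`), RADIAL monotonicity for torus-limit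
ground states at `t = 1`: `K₁(ωA) ≤ K₁(ωP)` for `A = (1, t'₁, U₁)`, `P = (1, c t'₁, c U₁)`, `c > 1`
(`IsTorusLimitOf.nnHopEnergy_radial_mono_of_groundStates`): the nn hopping amplitude is non-increasing
outward along radial rays.

§8 (crew hubbard-algo planner-p2 FOLD 2 (C2) / TARGET v0.5a §15.10 row (A), "anchor-LP family with
`θ`-dependent multipliers", checked sketch `AnchorChordBox.lean` restated in the tree's vocabulary): the
ONE-cap-ONE-cut case of §2 with `κ = λ = 1/|U − U_a|`, for EVERY state — `D(ω) ≤ (u − ℓ)/(U − U_a)` for an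
anchor below (`docc_le_chord_of_cap_of_cut`), `(ℓ − u)/(U_a − U) ≤ D(ω)` for an anchor above
(`chord_le_docc_of_cap_of_cut`), the bracket from two anchors (`docc_mem_Icc_chord_of_cap_of_cuts`); since
`u` is arbitrary these hold at every `U` of a segment at once with any cap PLANE `u(U)` (no shared
multiplier, no moment matrix), and under the TANGENT cap `u(U) = u₀ + (U − U₀)(u₀ − ℓ)/(U₀ − U_a)` the bound
is the constant `(u₀ − ℓ)/(U₀ − U_a)` (`docc_le_chord_of_tangentCap_of_cut`: the flat, "LP-valued" edge);
torus-limit ground-state forms fed from the certified table: `IsTorusLimitOf.chord_le_re_expect_docc_of_groundState`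
(mirror of §3's `re_expect_docc_le_chord_of_groundState`) and
`IsTorusLimitOf.re_expect_docc_le_chord_of_tangentCap_of_groundState`.

§9 (same crew, TARGET §15.10 row (A) "2-D cell closed form", sketch `docc_le_chord_of_cap_of_anchor_2d`):
the anchor cut may sit at a DIFFERENT diagonal hopping `t'_a ≠ t'_P`; the affine identity then leaves the
conjugate word `(t'_P − t'_a)·K₂(ω)`, priced by any certified range `|(t'_P − t'_a)·K₂(ω)| ≤ R`:
`D(ω) ≤ (u − ℓ + R)/(U − U_a)` (`docc_le_chord_of_cap_of_cut_of_abs_diagHop_le`), the lower twin for an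
anchor above (`chord_le_docc_of_cap_of_cut_of_abs_diagHop_le`), the forms fed from a `K₂` table
`|K₂(ω)| ≤ K`, `R = |t'_P − t'_a|·K` (`…_of_abs_K₂_le`), and the torus-limit ground-state rows fed from the
certified energy table (`IsTorusLimitOf.re_expect_docc_le_chord_of_cut_of_abs_K₂_le_of_groundState`,
`IsTorusLimitOf.chord_le_re_expect_docc_of_cut_of_abs_K₂_le_of_groundState`; the `K₂` range is e.g. the
kinematic row `IsTorusLimitOf.abs_meanEnergy_diagHop_le` of `HubbardOneBodyKinematicRows`, `K = 16/π²`).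

## Mathlib / tree search

REUSED: `InfVolFermionState.meanEnergy_hubbardTTPrime_affine/_smul`,
`IsTorusLimitOf.meanEnergy_hubbardTTPrime_eq_energyDensityTT'`,
`IsTorusLimitOf.energyDensityTT'_le_meanEnergy_hubbardTTPrime`, `IsTorusLimitOf.meanEnergy_onSite_eq_re_expect_docc`,
`mem_szSector_iff`. `lean search '(docc|kinetic|hop).*(le|ge)_of_.*(window|cap|cut)' --decl`: nothing;
the tree has the one-cut `U`-direction forms `IsTorusLimitOf.energyDensity2D_sub_le_mul_re_expect_docc`,
`energyDensity2D_le_of_forall_isTorusLimitOf_docc_le/_le_docc` (HubbardCorrelatorCertificate §EnergyFromDocc,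
`t' = 0`) and the supergradient `IsTorusLimitOf.energyDensityTT'_le_affine[_docc]` (one anchor, slopes of the
anchor state) — no multi-cut LP-dual row.

## References

* D. P. Bertsekas, *Nonlinear Programming*, 2nd ed., Athena Scientific (1999), §5.1.2 Prop. 5.1.3
  (weak duality, pointwise form). [cite: Bertsekas1999NonlinearProgramming, Prop. 5.1.3]
* T. Koma, H. Tasaki, J. Stat. Phys. 76 (1994) 745, §1 (energy slopes in a coupling bound the conjugate
  observable of every ground state). [cite: KomaTasaki1994, §1]
* D. Ruelle, *Statistical Mechanics* (1969), §3.4 (variational characterisation of the ground-state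
  energy density). [cite: Ruelle1969, §3.4]
* R. B. Griffiths, Phys. Rev. 152 (1966) 240, §II (monotonicity of the order parameter = one-sided
  derivatives of the concave energy). [cite: Griffiths1966, §II]
-/

noncomputable section

namespace Literature.MathematicalPhysics.QuantumLattice

open Matrix Finset HubbardWave0 Literature.Probability.LatticeModels ThermodynamicLimit
open _root_.Filter
open scoped _root_.Topology ComplexOrder BigOperators

namespace InfVolFermionState

/-! ### §1 The three energy coordinates of a state -/

/-- **Linearity in the couplings, coordinate form**: for every infinite-volume state `ω` and all
`t, t', U`, `e_{Φ(t,t',U)}(ω) = t·e_{Φ(1,0,0)}(ω) + t'·e_{Φ(0,1,0)}(ω) + U·e_{Φ(0,0,1)}(ω)`.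
[cite: BratteliKishimotoRobinson1978, §3 (mean energy functional)] -/
theorem meanEnergy_hubbardTTPrime_eq_coords (ω : InfVolFermionState 2) (t t' U : ℝ) :
    ω.meanEnergy (hubbardTTPrimeFermionInteraction t t' U) 1 =
      t * ω.meanEnergy (hubbardTTPrimeFermionInteraction 1 0 0) 1 +
        t' * ω.meanEnergy (hubbardTTPrimeFermionInteraction 0 1 0) 1 +
          U * ω.meanEnergy (hubbardTTPrimeFermionInteraction 0 0 1) 1 := by
  have h0 : ω.meanEnergy (hubbardTTPrimeFermionInteraction t 0 0) 1 =
      t * ω.meanEnergy (hubbardTTPrimeFermionInteraction 1 0 0) 1 := by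
    have h := ω.meanEnergy_hubbardTTPrime_smul t 1 0 0
    rwa [mul_one, mul_zero] at h
  rw [ω.meanEnergy_hubbardTTPrime_affine t 0 0 t' U, h0, sub_zero, sub_zero]
  ring

/-! ### §2 LP weak duality over a cap and finitely many cuts (every state) -/

/-- **Cap + cuts dual row, every state.** Let `ω` be any infinite-volume state on `ℤ²`, `t` a hopping
amplitude, `A` a finite set of anchors `k` with couplings `(t'_k, U_k) = (tp k, Uc k)`, certified cut
values `lo k ≤ e_{Φ(t, t'_k, U_k)}(ω)` and multipliers `lam k ≥ 0`, and let `e_{Φ(t,t',U)}(ω) ≤ u` (cap)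
with multiplier `κ ≥ 0`. Then
`(κt − Σ_k λ_k t)·K₁(ω) + (κt' − Σ_k λ_k t'_k)·K₂(ω) + (κU − Σ_k λ_k U_k)·D(ω) ≤ κu − Σ_k λ_k ℓ_k`
with `K₁, K₂, D` the unit NN-hopping, diagonal-hopping and on-site mean energies of `ω`.
(LP weak duality; no ground-state hypothesis.) [cite: Bertsekas1999NonlinearProgramming, Prop. 5.1.3] -/
theorem capCuts_dual_le (ω : InfVolFermionState 2) (t : ℝ) {ι : Type*} (A : Finset ι)
    (tp Uc lo lam : ι → ℝ) (hlam : ∀ k ∈ A, 0 ≤ lam k)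
    (hcut : ∀ k ∈ A, lo k ≤ ω.meanEnergy (hubbardTTPrimeFermionInteraction t (tp k) (Uc k)) 1)
    {κ u t' U : ℝ} (hκ : 0 ≤ κ)
    (hcap : ω.meanEnergy (hubbardTTPrimeFermionInteraction t t' U) 1 ≤ u) :
    (κ * t - ∑ k ∈ A, lam k * t) * ω.meanEnergy (hubbardTTPrimeFermionInteraction 1 0 0) 1 +
        (κ * t' - ∑ k ∈ A, lam k * tp k) * ω.meanEnergy (hubbardTTPrimeFermionInteraction 0 1 0) 1 +
          (κ * U - ∑ k ∈ A, lam k * Uc k) * ω.meanEnergy (hubbardTTPrimeFermionInteraction 0 0 1) 1 ≤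
      κ * u - ∑ k ∈ A, lam k * lo k := by
  set K₁ := ω.meanEnergy (hubbardTTPrimeFermionInteraction 1 0 0) 1 with hK₁
  set K₂ := ω.meanEnergy (hubbardTTPrimeFermionInteraction 0 1 0) 1 with hK₂
  set D := ω.meanEnergy (hubbardTTPrimeFermionInteraction 0 0 1) 1 with hD
  -- the cap and each cut in coordinates
  have hcap' : κ * (t * K₁ + t' * K₂ + U * D) ≤ κ * u := by
    rw [← ω.meanEnergy_hubbardTTPrime_eq_coords t t' U]
    exact mul_le_mul_of_nonneg_left hcap hκ
  have hcut' : ∑ k ∈ A, lam k * lo k ≤ ∑ k ∈ A, lam k * (t * K₁ + tp k * K₂ + Uc k * D) := by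
    refine Finset.sum_le_sum fun k hk => ?_
    rw [← ω.meanEnergy_hubbardTTPrime_eq_coords t (tp k) (Uc k)]
    exact mul_le_mul_of_nonneg_left (hcut k hk) (hlam k hk)
  -- regroup the left-hand side as `κ·(a·x) − Σ λ_k (a_k·x)`
  have hre : (κ * t - ∑ k ∈ A, lam k * t) * K₁ + (κ * t' - ∑ k ∈ A, lam k * tp k) * K₂ +
        (κ * U - ∑ k ∈ A, lam k * Uc k) * D =
      κ * (t * K₁ + t' * K₂ + U * D) - ∑ k ∈ A, lam k * (t * K₁ + tp k * K₂ + Uc k * D) := by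
    have hs : ∑ k ∈ A, lam k * (t * K₁ + tp k * K₂ + Uc k * D) =
        (∑ k ∈ A, lam k * t) * K₁ + (∑ k ∈ A, lam k * tp k) * K₂ + (∑ k ∈ A, lam k * Uc k) * D := by
      rw [Finset.sum_mul, Finset.sum_mul, Finset.sum_mul, ← Finset.sum_add_distrib,
        ← Finset.sum_add_distrib]
      exact Finset.sum_congr rfl fun k _ => by ring
    rw [hs]; ring
  rw [hre]
  linarith

/-! ### §3 Torus-limit ground states: cap and cuts from the certified energy table -/

/-- **Cap + cuts dual row for torus-limit ground states** (the fast layer's program-free rows). Let `ω`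
be a torus limit along `Ls → ∞` of unit ground states of `hubbardTorusTT' (Ls j) t t' U` in the sectors
`(rectN n (Ls j), S^z = 0)`, `U ≥ 0`, `0 ≤ n < 2`; let `e(t,t',U,n) ≤ u` (certified cap), and for each
anchor `k ∈ A` let `U_k ≥ 0` and `ℓ_k ≤ e(t,t'_k,U_k,n)` (certified cuts). Then for all multipliers
`κ ≥ 0`, `λ_k ≥ 0`:
`(κt − Σ_k λ_k t)·e_{Φ(1,0,0)}(ω) + (κt' − Σ_k λ_k t'_k)·e_{Φ(0,1,0)}(ω) + (κU − Σ_k λ_k U_k)·Re ω(n_{0↑}n_{0↓})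
  ≤ κu − Σ_k λ_k ℓ_k`.
(Cap: `e_Φ(ω) = e(t,t',U,n) ≤ u`; cuts: the variational inequality at every anchor; then
`capCuts_dual_le`.) [cite: Bertsekas1999NonlinearProgramming, Prop. 5.1.3] [cite: KomaTasaki1994, §1] -/
theorem IsTorusLimitOf.capCuts_dual_le_of_groundState (t t' : ℝ) {U : ℝ} (hU : 0 ≤ U) {n : ℝ}
    (hn0 : 0 ≤ n) (hn2 : n < 2)
    {ω : InfVolFermionState 2} {ψ : ∀ L, Fock (Orb (FermionTorus 2 L))} {Ls : ℕ → ℕ}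
    (h : ω.IsTorusLimitOf ψ Ls) (hLs : Tendsto Ls atTop atTop)
    (hψ : ∀ j, IsGroundStateInSector (hubbardTorusTT' (Ls j) t t' U) (rectN n (Ls j)) 0 (ψ (Ls j)))
    (h1 : ∀ j, star (ψ (Ls j)) ⬝ᵥ ψ (Ls j) = 1)
    {u : ℝ} (hu : energyDensityTT' t t' U n ≤ u)
    {ι : Type*} (A : Finset ι) (tp Uc lo lam : ι → ℝ) (hUc : ∀ k ∈ A, 0 ≤ Uc k)
    (hlo : ∀ k ∈ A, lo k ≤ energyDensityTT' t (tp k) (Uc k) n) (hlam : ∀ k ∈ A, 0 ≤ lam k)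
    {κ : ℝ} (hκ : 0 ≤ κ) :
    (κ * t - ∑ k ∈ A, lam k * t) * ω.meanEnergy (hubbardTTPrimeFermionInteraction 1 0 0) 1 +
        (κ * t' - ∑ k ∈ A, lam k * tp k) * ω.meanEnergy (hubbardTTPrimeFermionInteraction 0 1 0) 1 +
          (κ * U - ∑ k ∈ A, lam k * Uc k) *
            (ω.expect ({0} : Finset (Site 2))
              (nAt 0 (Finset.mem_singleton_self 0) 0 * nAt 0 (Finset.mem_singleton_self 0) 1)).re ≤
      κ * u - ∑ k ∈ A, lam k * lo k := by
  have hN : ∀ j, IsNParticle (rectN n (Ls j)) (ψ (Ls j)) := fun j =>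
    ((mem_szSector_iff _ _ _).1 (hψ j).1).1
  have hcap : ω.meanEnergy (hubbardTTPrimeFermionInteraction t t' U) 1 ≤ u := by
    rw [h.meanEnergy_hubbardTTPrime_eq_energyDensityTT' t t' hU hn0 hn2 hLs hψ h1]; exact hu
  have hcut : ∀ k ∈ A, lo k ≤ ω.meanEnergy (hubbardTTPrimeFermionInteraction t (tp k) (Uc k)) 1 :=
    fun k hk => (hlo k hk).trans
      (h.energyDensityTT'_le_meanEnergy_hubbardTTPrime t (tp k) (hUc k hk) hn0 hn2 hLs hN h1)
  rw [← h.meanEnergy_onSite_eq_re_expect_docc hLs]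
  exact ω.capCuts_dual_le t A tp Uc lo lam hlam hcut hκ hcap

/-- **The `U`-chord for the double occupancy** (one cut, `t'_k = t'`, `U_k < U`): under the hypotheses of
`capCuts_dual_le_of_groundState`, if `ℓ ≤ e(t,t',U₀,n)` with `0 ≤ U₀ < U` then
`Re ω(n_{0↑}n_{0↓}) ≤ (u − ℓ)/(U − U₀)` — the `t–t'` twin of
`energyDensity2D_sub_le_mul_re_expect_docc` read as a docc CEILING from an energy window.
[cite: KomaTasaki1994, §1] -/
theorem IsTorusLimitOf.re_expect_docc_le_chord_of_groundState (t t' : ℝ) {U : ℝ} (hU : 0 ≤ U) {n : ℝ}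
    (hn0 : 0 ≤ n) (hn2 : n < 2)
    {ω : InfVolFermionState 2} {ψ : ∀ L, Fock (Orb (FermionTorus 2 L))} {Ls : ℕ → ℕ}
    (h : ω.IsTorusLimitOf ψ Ls) (hLs : Tendsto Ls atTop atTop)
    (hψ : ∀ j, IsGroundStateInSector (hubbardTorusTT' (Ls j) t t' U) (rectN n (Ls j)) 0 (ψ (Ls j)))
    (h1 : ∀ j, star (ψ (Ls j)) ⬝ᵥ ψ (Ls j) = 1)
    {u : ℝ} (hu : energyDensityTT' t t' U n ≤ u) {U₀ ℓ : ℝ} (hU₀ : 0 ≤ U₀) (hU₀U : U₀ < U)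
    (hℓ : ℓ ≤ energyDensityTT' t t' U₀ n) :
    (ω.expect ({0} : Finset (Site 2))
        (nAt 0 (Finset.mem_singleton_self 0) 0 * nAt 0 (Finset.mem_singleton_self 0) 1)).re ≤
      (u - ℓ) / (U - U₀) := by
  have hd : 0 < U - U₀ := sub_pos.2 hU₀U
  have key := h.capCuts_dual_le_of_groundState t t' hU hn0 hn2 hLs hψ h1 hu ({()} : Finset Unit)
    (fun _ => t') (fun _ => U₀) (fun _ => ℓ) (fun _ => (U - U₀)⁻¹) (fun _ _ => hU₀)
    (fun _ _ => hℓ) (fun _ _ => (inv_pos.2 hd).le) (κ := (U - U₀)⁻¹) (inv_pos.2 hd).le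
  simp only [Finset.sum_singleton, sub_self, zero_mul, zero_add] at key
  rw [← mul_sub, inv_mul_cancel₀ hd.ne', one_mul, ← mul_sub] at key
  rwa [div_eq_inv_mul]

/-! ### §4 Cross-variational monotonicity in `U` (kinetic ceilings move up the `U`-ray, docc down) -/

/-- **Cross-variational monotonicity, every pair of states.** Let `ωA, ωP` be two states and
`U_A < U_P` two couplings (same `t, t'`) such that `ωP` does not lose to `ωA` at `U_P` and `ωA` does not
lose to `ωP` at `U_A`: `e_{Φ(t,t',U_P)}(ωP) ≤ e_{Φ(t,t',U_P)}(ωA)` and `e_{Φ(t,t',U_A)}(ωA) ≤ e_{Φ(t,t',U_A)}(ωP)`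
(e.g. two torus-limit ground states at the same `t'` and density). Then the on-site energy is
non-increasing, `D(ωP) ≤ D(ωA)`, and — if moreover `0 ≤ U_A` — the one-body energy is non-decreasing,
`e_{Φ(t,t',0)}(ωA) ≤ e_{Φ(t,t',0)}(ωP)`. (Add the two inequalities written in coordinates:
`(U_P − U_A)(D(ωP) − D(ωA)) ≤ 0`; then `X(ωA) ≤ X(ωP) + U_A (D(ωP) − D(ωA)) ≤ X(ωP)`.) Koma–Tasaki §1 /
Griffiths 1966 §II: the conjugate observable of a coupling is monotone along the coupling for energy
minimisers; no differentiability, no uniqueness. [cite: KomaTasaki1994, §1] [cite: Griffiths1966, §II] -/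
theorem docc_le_and_oneBody_le_of_cross_variational (ωP ωA : InfVolFermionState 2) {t t' UA UP : ℝ}
    (hU : UA < UP)
    (hP : ωP.meanEnergy (hubbardTTPrimeFermionInteraction t t' UP) 1 ≤
      ωA.meanEnergy (hubbardTTPrimeFermionInteraction t t' UP) 1)
    (hA : ωA.meanEnergy (hubbardTTPrimeFermionInteraction t t' UA) 1 ≤
      ωP.meanEnergy (hubbardTTPrimeFermionInteraction t t' UA) 1) :
    ωP.meanEnergy (hubbardTTPrimeFermionInteraction 0 0 1) 1 ≤
        ωA.meanEnergy (hubbardTTPrimeFermionInteraction 0 0 1) 1 ∧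
      (0 ≤ UA → ωA.meanEnergy (hubbardTTPrimeFermionInteraction t t' 0) 1 ≤
        ωP.meanEnergy (hubbardTTPrimeFermionInteraction t t' 0) 1) := by
  -- write everything in terms of `X(ω) = e_{Φ(t,t',0)}(ω)` and `D(ω) = e_{Φ(0,0,1)}(ω)`
  have hP' := ωP.meanEnergy_hubbardTTPrime_affine t t' 0 t' UP
  have hA' := ωA.meanEnergy_hubbardTTPrime_affine t t' 0 t' UP
  have hP'' := ωP.meanEnergy_hubbardTTPrime_affine t t' 0 t' UA
  have hA'' := ωA.meanEnergy_hubbardTTPrime_affine t t' 0 t' UA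
  simp only [sub_zero, sub_self, zero_mul, add_zero] at hP' hA' hP'' hA''
  rw [hP', hA'] at hP
  rw [hP'', hA''] at hA
  have hD : ωP.meanEnergy (hubbardTTPrimeFermionInteraction 0 0 1) 1 ≤
      ωA.meanEnergy (hubbardTTPrimeFermionInteraction 0 0 1) 1 := by nlinarith
  exact ⟨hD, fun hUA => by nlinarith⟩

/-- **Tier-1 transport along a `U`-ray for torus-limit ground states** (zero-cost rule "T-mono" of the
crew's screen): if `ωA`, `ωP` are torus limits of unit sector ground states at `(t, t', U_A)` and
`(t, t', U_P)` with the same density `n` (`0 ≤ n < 2`) and `0 ≤ U_A < U_P`, then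
`Re ωP(n_{0↑}n_{0↓}) ≤ Re ωA(n_{0↑}n_{0↓})` (the double occupancy is non-increasing in `U`) and
`e_{Φ(t,t',0)}(ωA) ≤ e_{Φ(t,t',0)}(ωP)` (the one-body energy is non-decreasing in `U`): a certified kinetic
CEILING `−e_{Φ(t,t',0)} ≤ c` at an anchor holds at every larger `U` on its `(t', n)`-ray, a kinetic FLOOR at
every smaller `U`, a docc ceiling at every larger `U`, a docc floor at every smaller `U`. (The two cross
variational inequalities are `meanEnergy_hubbardTTPrime_eq_energyDensityTT'` at the own coupling and
`energyDensityTT'_le_meanEnergy_hubbardTTPrime` at the other one.) [cite: KomaTasaki1994, §1] [cite: Griffiths1966, §II] -/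
theorem IsTorusLimitOf.docc_le_and_oneBody_le_of_groundStates (t t' : ℝ) {UA UP : ℝ} (hUA : 0 ≤ UA)
    (hU : UA < UP) {n : ℝ} (hn0 : 0 ≤ n) (hn2 : n < 2)
    {ωA ωP : InfVolFermionState 2} {ψA ψP : ∀ L, Fock (Orb (FermionTorus 2 L))} {LsA LsP : ℕ → ℕ}
    (hA : ωA.IsTorusLimitOf ψA LsA) (hLsA : Tendsto LsA atTop atTop)
    (hψA : ∀ j, IsGroundStateInSector (hubbardTorusTT' (LsA j) t t' UA) (rectN n (LsA j)) 0 (ψA (LsA j)))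
    (h1A : ∀ j, star (ψA (LsA j)) ⬝ᵥ ψA (LsA j) = 1)
    (hP : ωP.IsTorusLimitOf ψP LsP) (hLsP : Tendsto LsP atTop atTop)
    (hψP : ∀ j, IsGroundStateInSector (hubbardTorusTT' (LsP j) t t' UP) (rectN n (LsP j)) 0 (ψP (LsP j)))
    (h1P : ∀ j, star (ψP (LsP j)) ⬝ᵥ ψP (LsP j) = 1) :
    (ωP.expect ({0} : Finset (Site 2))
        (nAt 0 (Finset.mem_singleton_self 0) 0 * nAt 0 (Finset.mem_singleton_self 0) 1)).re ≤
      (ωA.expect ({0} : Finset (Site 2))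
        (nAt 0 (Finset.mem_singleton_self 0) 0 * nAt 0 (Finset.mem_singleton_self 0) 1)).re ∧
    ωA.meanEnergy (hubbardTTPrimeFermionInteraction t t' 0) 1 ≤
      ωP.meanEnergy (hubbardTTPrimeFermionInteraction t t' 0) 1 := by
  have hUP : 0 ≤ UP := hUA.trans hU.le
  have hNA : ∀ j, IsNParticle (rectN n (LsA j)) (ψA (LsA j)) := fun j =>
    ((mem_szSector_iff _ _ _).1 (hψA j).1).1
  have hNP : ∀ j, IsNParticle (rectN n (LsP j)) (ψP (LsP j)) := fun j =>
    ((mem_szSector_iff _ _ _).1 (hψP j).1).1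
  -- `ωP` at its own coupling realises `e(t,t',U_P,n)`, which `ωA` cannot undercut; and symmetrically
  have hcrossP : ωP.meanEnergy (hubbardTTPrimeFermionInteraction t t' UP) 1 ≤
      ωA.meanEnergy (hubbardTTPrimeFermionInteraction t t' UP) 1 := by
    rw [hP.meanEnergy_hubbardTTPrime_eq_energyDensityTT' t t' hUP hn0 hn2 hLsP hψP h1P]
    exact hA.energyDensityTT'_le_meanEnergy_hubbardTTPrime t t' hUP hn0 hn2 hLsA hNA h1A
  have hcrossA : ωA.meanEnergy (hubbardTTPrimeFermionInteraction t t' UA) 1 ≤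
      ωP.meanEnergy (hubbardTTPrimeFermionInteraction t t' UA) 1 := by
    rw [hA.meanEnergy_hubbardTTPrime_eq_energyDensityTT' t t' hUA hn0 hn2 hLsA hψA h1A]
    exact hP.energyDensityTT'_le_meanEnergy_hubbardTTPrime t t' hUA hn0 hn2 hLsP hNP h1P
  obtain ⟨hD, hX⟩ := docc_le_and_oneBody_le_of_cross_variational ωP ωA hU hcrossP hcrossA
  refine ⟨?_, hX hUA⟩
  rw [← hP.meanEnergy_onSite_eq_re_expect_docc hLsP, ← hA.meanEnergy_onSite_eq_re_expect_docc hLsA]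
  exact hD

/-! ### §5 The free double-occupancy density `(n/2)²` is a ceiling for every repulsive ground state -/

/-- **`Re ω(n_{0↑}n_{0↓}) ≤ (n/2)²`** for every torus limit `ω` of unit `(rectN n, S^z = 0)` sector
ground states at `(t, t', U)` with `U > 0`, `0 ≤ n < 2`: the `U`-chord of
`IsTorusLimitOf.re_expect_docc_le_chord_of_groundState` between the cut `e(t,t',0,n)` at `U₀ = 0` and the
Hartree–Fock cap `e(t,t',U,n) ≤ e(t,t',0,n) + U(n/2)²` (plane-wave Slater determinants are variational,
Bach–Lieb–Solovej (2c.36)); i.e. the interacting ground state never has MORE double occupancy than the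
free Fermi sea. [cite: KomaTasaki1994, §1] [cite: BachLiebSolovej1994, eq. (2c.36)] -/
theorem IsTorusLimitOf.re_expect_docc_le_sq_half_density_of_groundState (t t' : ℝ) {U : ℝ} (hU : 0 < U)
    {n : ℝ} (hn0 : 0 ≤ n) (hn2 : n < 2)
    {ω : InfVolFermionState 2} {ψ : ∀ L, Fock (Orb (FermionTorus 2 L))} {Ls : ℕ → ℕ}
    (h : ω.IsTorusLimitOf ψ Ls) (hLs : Tendsto Ls atTop atTop)
    (hψ : ∀ j, IsGroundStateInSector (hubbardTorusTT' (Ls j) t t' U) (rectN n (Ls j)) 0 (ψ (Ls j)))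
    (h1 : ∀ j, star (ψ (Ls j)) ⬝ᵥ ψ (Ls j) = 1) :
    (ω.expect ({0} : Finset (Site 2))
        (nAt 0 (Finset.mem_singleton_self 0) 0 * nAt 0 (Finset.mem_singleton_self 0) 1)).re ≤
      (n / 2) ^ 2 := by
  have hcap := TTPrimeFree.energyDensityTT'_le_free_add_interaction t t' hU.le hn0 hn2
  have hch := h.re_expect_docc_le_chord_of_groundState t t' hU.le hn0 hn2 hLs hψ h1 hcap le_rfl hU
    (le_refl (energyDensityTT' t t' 0 n))
  have e : (energyDensityTT' t t' 0 n + U * (n / 2) ^ 2 - energyDensityTT' t t' 0 n) / (U - 0) =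
      (n / 2) ^ 2 := by
    rw [sub_zero]
    field_simp
    ring
  rwa [e] at hch

/-- The same ceiling for the double-occupancy coordinate `D(ω) = e_{Φ(0,0,1)}(ω)`:
`D(ω) ≤ (n/2)²` for every torus-limit ground state at `U > 0`. [cite: KomaTasaki1994, §1] -/
theorem IsTorusLimitOf.docc_le_sq_half_density_of_groundState (t t' : ℝ) {U : ℝ} (hU : 0 < U)
    {n : ℝ} (hn0 : 0 ≤ n) (hn2 : n < 2)
    {ω : InfVolFermionState 2} {ψ : ∀ L, Fock (Orb (FermionTorus 2 L))} {Ls : ℕ → ℕ}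
    (h : ω.IsTorusLimitOf ψ Ls) (hLs : Tendsto Ls atTop atTop)
    (hψ : ∀ j, IsGroundStateInSector (hubbardTorusTT' (Ls j) t t' U) (rectN n (Ls j)) 0 (ψ (Ls j)))
    (h1 : ∀ j, star (ψ (Ls j)) ⬝ᵥ ψ (Ls j) = 1) :
    ω.meanEnergy (hubbardTTPrimeFermionInteraction 0 0 1) 1 ≤ (n / 2) ^ 2 := by
  rw [h.meanEnergy_onSite_eq_re_expect_docc hLs]
  exact h.re_expect_docc_le_sq_half_density_of_groundState t t' hU hn0 hn2 hLs hψ h1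

/-! ### §6 The directional (cross-variational) row for an arbitrary pair of couplings (L-7) -/

/-- **Cross-variational monotonicity in an arbitrary direction of the `(t', U)` plane.** For two states
`ωP, ωA` and two couplings `(t, t'_A, U_A)`, `(t, t'_P, U_P)` with the two cross energy inequalities
`e_{Φ(t,t'_P,U_P)}(ωP) ≤ e_{Φ(t,t'_P,U_P)}(ωA)` and `e_{Φ(t,t'_A,U_A)}(ωA) ≤ e_{Φ(t,t'_A,U_A)}(ωP)`:
`(U_P − U_A)·(D(ωP) − D(ωA)) + (t'_P − t'_A)·(A(ωP) − A(ωA)) ≤ 0`. (Write both inequalities in the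
coordinates of `meanEnergy_hubbardTTPrime_affine` based at `(t'_A, U_A)` and add.)
[cite: KomaTasaki1994, §1] [cite: Griffiths1966, §II] -/
theorem directional_le_of_cross_variational (ωP ωA : InfVolFermionState 2) (t t'A UA t'P UP : ℝ)
    (hP : ωP.meanEnergy (hubbardTTPrimeFermionInteraction t t'P UP) 1 ≤
      ωA.meanEnergy (hubbardTTPrimeFermionInteraction t t'P UP) 1)
    (hA : ωA.meanEnergy (hubbardTTPrimeFermionInteraction t t'A UA) 1 ≤
      ωP.meanEnergy (hubbardTTPrimeFermionInteraction t t'A UA) 1) :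
    (UP - UA) * (ωP.meanEnergy (hubbardTTPrimeFermionInteraction 0 0 1) 1 -
        ωA.meanEnergy (hubbardTTPrimeFermionInteraction 0 0 1) 1) +
      (t'P - t'A) * (ωP.meanEnergy (hubbardTTPrimeFermionInteraction 0 1 0) 1 -
        ωA.meanEnergy (hubbardTTPrimeFermionInteraction 0 1 0) 1) ≤ 0 := by
  have hP' := ωP.meanEnergy_hubbardTTPrime_affine t t'A UA t'P UP
  have hA' := ωA.meanEnergy_hubbardTTPrime_affine t t'A UA t'P UP
  rw [hP', hA'] at hP
  nlinarith [hP, hA]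

/-- **The `t'`-axis case: the unit diagonal-hopping energy `A(ω) = e_{Φ(0,1,0)}(ω)` is non-increasing in
`t'`** (equivalently the nnn hopping amplitude `−A` is non-decreasing in `t'`) for cross-variational pairs at
the same `(t, U)`: `t'_A < t'_P` ⇒ `A(ωP) ≤ A(ωA)`. Hence a certified CEILING on `−A` at `t'_P` holds at every
smaller `t'` on the `(U, n)`-ray and a certified FLOOR at `t'_A` at every larger `t'` — the `K₂` analogue of
T-mono. [cite: KomaTasaki1994, §1] [cite: Griffiths1966, §II] -/
theorem diagHopEnergy_anti_of_cross_variational (ωP ωA : InfVolFermionState 2) {t t'A t'P U : ℝ}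
    (ht' : t'A < t'P)
    (hP : ωP.meanEnergy (hubbardTTPrimeFermionInteraction t t'P U) 1 ≤
      ωA.meanEnergy (hubbardTTPrimeFermionInteraction t t'P U) 1)
    (hA : ωA.meanEnergy (hubbardTTPrimeFermionInteraction t t'A U) 1 ≤
      ωP.meanEnergy (hubbardTTPrimeFermionInteraction t t'A U) 1) :
    ωP.meanEnergy (hubbardTTPrimeFermionInteraction 0 1 0) 1 ≤
      ωA.meanEnergy (hubbardTTPrimeFermionInteraction 0 1 0) 1 := by
  have h := directional_le_of_cross_variational ωP ωA t t'A U t'P U hP hA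
  rw [sub_self, zero_mul, zero_add] at h
  nlinarith [h, ht']

/-- **Directional row for torus-limit ground states** (the LAYER 0b input of R-9 (d)): if `ωA`, `ωP` are
torus limits of unit sector ground states at `(t, t'_A, U_A)` and `(t, t'_P, U_P)` with the same density `n`
(`0 ≤ n < 2`, `0 ≤ U_A`, `0 ≤ U_P`), then
`(U_P − U_A)·(D(ωP) − D(ωA)) + (t'_P − t'_A)·(A(ωP) − A(ωA)) ≤ 0` (the two cross inequalities are
`meanEnergy_hubbardTTPrime_eq_energyDensityTT'` at the own coupling and
`energyDensityTT'_le_meanEnergy_hubbardTTPrime` at the other one). [cite: KomaTasaki1994, §1] -/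
theorem IsTorusLimitOf.directional_le_of_groundStates (t t'A t'P : ℝ) {UA UP : ℝ} (hUA : 0 ≤ UA)
    (hUP : 0 ≤ UP) {n : ℝ} (hn0 : 0 ≤ n) (hn2 : n < 2)
    {ωA ωP : InfVolFermionState 2} {ψA ψP : ∀ L, Fock (Orb (FermionTorus 2 L))} {LsA LsP : ℕ → ℕ}
    (hA : ωA.IsTorusLimitOf ψA LsA) (hLsA : Tendsto LsA atTop atTop)
    (hψA : ∀ j, IsGroundStateInSector (hubbardTorusTT' (LsA j) t t'A UA) (rectN n (LsA j)) 0 (ψA (LsA j)))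
    (h1A : ∀ j, star (ψA (LsA j)) ⬝ᵥ ψA (LsA j) = 1)
    (hP : ωP.IsTorusLimitOf ψP LsP) (hLsP : Tendsto LsP atTop atTop)
    (hψP : ∀ j, IsGroundStateInSector (hubbardTorusTT' (LsP j) t t'P UP) (rectN n (LsP j)) 0 (ψP (LsP j)))
    (h1P : ∀ j, star (ψP (LsP j)) ⬝ᵥ ψP (LsP j) = 1) :
    (UP - UA) * (ωP.meanEnergy (hubbardTTPrimeFermionInteraction 0 0 1) 1 -
        ωA.meanEnergy (hubbardTTPrimeFermionInteraction 0 0 1) 1) +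
      (t'P - t'A) * (ωP.meanEnergy (hubbardTTPrimeFermionInteraction 0 1 0) 1 -
        ωA.meanEnergy (hubbardTTPrimeFermionInteraction 0 1 0) 1) ≤ 0 := by
  have hNA : ∀ j, IsNParticle (rectN n (LsA j)) (ψA (LsA j)) := fun j =>
    ((mem_szSector_iff _ _ _).1 (hψA j).1).1
  have hNP : ∀ j, IsNParticle (rectN n (LsP j)) (ψP (LsP j)) := fun j =>
    ((mem_szSector_iff _ _ _).1 (hψP j).1).1
  have hcrossP : ωP.meanEnergy (hubbardTTPrimeFermionInteraction t t'P UP) 1 ≤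
      ωA.meanEnergy (hubbardTTPrimeFermionInteraction t t'P UP) 1 := by
    rw [hP.meanEnergy_hubbardTTPrime_eq_energyDensityTT' t t'P hUP hn0 hn2 hLsP hψP h1P]
    exact hA.energyDensityTT'_le_meanEnergy_hubbardTTPrime t t'P hUP hn0 hn2 hLsA hNA h1A
  have hcrossA : ωA.meanEnergy (hubbardTTPrimeFermionInteraction t t'A UA) 1 ≤
      ωP.meanEnergy (hubbardTTPrimeFermionInteraction t t'A UA) 1 := by
    rw [hA.meanEnergy_hubbardTTPrime_eq_energyDensityTT' t t'A hUA hn0 hn2 hLsA hψA h1A]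
    exact hP.energyDensityTT'_le_meanEnergy_hubbardTTPrime t t'A hUA hn0 hn2 hLsP hNP h1P
  exact directional_le_of_cross_variational ωP ωA t t'A UA t'P UP hcrossP hcrossA

/-- **`t'`-axis case for torus-limit ground states**: two torus limits of unit sector ground states at
`(t, t'_A, U)` and `(t, t'_P, U)` (`U ≥ 0`, same density `n`, `t'_A < t'_P`) satisfy `A(ωP) ≤ A(ωA)` — the
unit diagonal-hopping energy per site is non-increasing in `t'` (a certified ceiling on `−A` at `t'_P`
holds at every smaller `t'` on the `(U, n)`-ray, a floor at `t'_A` at every larger `t'`).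
[cite: KomaTasaki1994, §1] [cite: Griffiths1966, §II] -/
theorem IsTorusLimitOf.diagHopEnergy_anti_of_groundStates (t : ℝ) {t'A t'P : ℝ} (ht' : t'A < t'P)
    {U : ℝ} (hU : 0 ≤ U) {n : ℝ} (hn0 : 0 ≤ n) (hn2 : n < 2)
    {ωA ωP : InfVolFermionState 2} {ψA ψP : ∀ L, Fock (Orb (FermionTorus 2 L))} {LsA LsP : ℕ → ℕ}
    (hA : ωA.IsTorusLimitOf ψA LsA) (hLsA : Tendsto LsA atTop atTop)
    (hψA : ∀ j, IsGroundStateInSector (hubbardTorusTT' (LsA j) t t'A U) (rectN n (LsA j)) 0 (ψA (LsA j)))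
    (h1A : ∀ j, star (ψA (LsA j)) ⬝ᵥ ψA (LsA j) = 1)
    (hP : ωP.IsTorusLimitOf ψP LsP) (hLsP : Tendsto LsP atTop atTop)
    (hψP : ∀ j, IsGroundStateInSector (hubbardTorusTT' (LsP j) t t'P U) (rectN n (LsP j)) 0 (ψP (LsP j)))
    (h1P : ∀ j, star (ψP (LsP j)) ⬝ᵥ ψP (LsP j) = 1) :
    ωP.meanEnergy (hubbardTTPrimeFermionInteraction 0 1 0) 1 ≤
      ωA.meanEnergy (hubbardTTPrimeFermionInteraction 0 1 0) 1 := by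
  have h := IsTorusLimitOf.directional_le_of_groundStates t t'A t'P hU hU hn0 hn2 hA hLsA hψA h1A hP
    hLsP hψP h1P
  rw [sub_self, zero_mul, zero_add] at h
  nlinarith [h, ht']

/-- **Full three-coupling directional row** (the `t`-component included, for R-9 (c)'s radial/`K₁`
use): for two states and two coupling vectors `(t_A, t'_A, U_A)`, `(t_P, t'_P, U_P)` with the two cross
energy inequalities, `(t_P − t_A)·(K₁(ωP) − K₁(ωA)) + (t'_P − t'_A)·(K₂(ωP) − K₂(ωA)) +
(U_P − U_A)·(D(ωP) − D(ωA)) ≤ 0` — the supergradient map `(K₁, K₂, D)` is monotone (coordinates of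
`meanEnergy_hubbardTTPrime_eq_coords`, add the two inequalities). [cite: KomaTasaki1994, §1] [cite: Griffiths1966, §II] -/
theorem directional3_le_of_cross_variational (ωP ωA : InfVolFermionState 2) (tA t'A UA tP t'P UP : ℝ)
    (hP : ωP.meanEnergy (hubbardTTPrimeFermionInteraction tP t'P UP) 1 ≤
      ωA.meanEnergy (hubbardTTPrimeFermionInteraction tP t'P UP) 1)
    (hA : ωA.meanEnergy (hubbardTTPrimeFermionInteraction tA t'A UA) 1 ≤
      ωP.meanEnergy (hubbardTTPrimeFermionInteraction tA t'A UA) 1) :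
    (tP - tA) * (ωP.meanEnergy (hubbardTTPrimeFermionInteraction 1 0 0) 1 -
        ωA.meanEnergy (hubbardTTPrimeFermionInteraction 1 0 0) 1) +
      (t'P - t'A) * (ωP.meanEnergy (hubbardTTPrimeFermionInteraction 0 1 0) 1 -
        ωA.meanEnergy (hubbardTTPrimeFermionInteraction 0 1 0) 1) +
      (UP - UA) * (ωP.meanEnergy (hubbardTTPrimeFermionInteraction 0 0 1) 1 -
        ωA.meanEnergy (hubbardTTPrimeFermionInteraction 0 0 1) 1) ≤ 0 := by
  rw [ωP.meanEnergy_hubbardTTPrime_eq_coords tP t'P UP, ωA.meanEnergy_hubbardTTPrime_eq_coords tP t'P UP]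
    at hP
  rw [ωA.meanEnergy_hubbardTTPrime_eq_coords tA t'A UA, ωP.meanEnergy_hubbardTTPrime_eq_coords tA t'A UA]
    at hA
  nlinarith [hP, hA]

/-- **Three-coupling directional row for torus-limit ground states**: torus limits of unit sector
ground states at `(t_A, t'_A, U_A)` and `(t_P, t'_P, U_P)` (`U_A, U_P ≥ 0`, same density `n`) satisfy the
monotonicity inequality of `directional3_le_of_cross_variational`. [cite: KomaTasaki1994, §1] -/
theorem IsTorusLimitOf.directional3_le_of_groundStates (tA t'A tP t'P : ℝ) {UA UP : ℝ} (hUA : 0 ≤ UA)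
    (hUP : 0 ≤ UP) {n : ℝ} (hn0 : 0 ≤ n) (hn2 : n < 2)
    {ωA ωP : InfVolFermionState 2} {ψA ψP : ∀ L, Fock (Orb (FermionTorus 2 L))} {LsA LsP : ℕ → ℕ}
    (hA : ωA.IsTorusLimitOf ψA LsA) (hLsA : Tendsto LsA atTop atTop)
    (hψA : ∀ j, IsGroundStateInSector (hubbardTorusTT' (LsA j) tA t'A UA) (rectN n (LsA j)) 0 (ψA (LsA j)))
    (h1A : ∀ j, star (ψA (LsA j)) ⬝ᵥ ψA (LsA j) = 1)
    (hP : ωP.IsTorusLimitOf ψP LsP) (hLsP : Tendsto LsP atTop atTop)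
    (hψP : ∀ j, IsGroundStateInSector (hubbardTorusTT' (LsP j) tP t'P UP) (rectN n (LsP j)) 0 (ψP (LsP j)))
    (h1P : ∀ j, star (ψP (LsP j)) ⬝ᵥ ψP (LsP j) = 1) :
    (tP - tA) * (ωP.meanEnergy (hubbardTTPrimeFermionInteraction 1 0 0) 1 -
        ωA.meanEnergy (hubbardTTPrimeFermionInteraction 1 0 0) 1) +
      (t'P - t'A) * (ωP.meanEnergy (hubbardTTPrimeFermionInteraction 0 1 0) 1 -
        ωA.meanEnergy (hubbardTTPrimeFermionInteraction 0 1 0) 1) +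
      (UP - UA) * (ωP.meanEnergy (hubbardTTPrimeFermionInteraction 0 0 1) 1 -
        ωA.meanEnergy (hubbardTTPrimeFermionInteraction 0 0 1) 1) ≤ 0 := by
  have hNA : ∀ j, IsNParticle (rectN n (LsA j)) (ψA (LsA j)) := fun j =>
    ((mem_szSector_iff _ _ _).1 (hψA j).1).1
  have hNP : ∀ j, IsNParticle (rectN n (LsP j)) (ψP (LsP j)) := fun j =>
    ((mem_szSector_iff _ _ _).1 (hψP j).1).1
  have hcrossP : ωP.meanEnergy (hubbardTTPrimeFermionInteraction tP t'P UP) 1 ≤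
      ωA.meanEnergy (hubbardTTPrimeFermionInteraction tP t'P UP) 1 := by
    rw [hP.meanEnergy_hubbardTTPrime_eq_energyDensityTT' tP t'P hUP hn0 hn2 hLsP hψP h1P]
    exact hA.energyDensityTT'_le_meanEnergy_hubbardTTPrime tP t'P hUP hn0 hn2 hLsA hNA h1A
  have hcrossA : ωA.meanEnergy (hubbardTTPrimeFermionInteraction tA t'A UA) 1 ≤
      ωP.meanEnergy (hubbardTTPrimeFermionInteraction tA t'A UA) 1 := by
    rw [hA.meanEnergy_hubbardTTPrime_eq_energyDensityTT' tA t'A hUA hn0 hn2 hLsA hψA h1A]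
    exact hP.energyDensityTT'_le_meanEnergy_hubbardTTPrime tA t'A hUA hn0 hn2 hLsP hNP h1P
  exact directional3_le_of_cross_variational ωP ωA tA t'A UA tP t'P UP hcrossP hcrossA

/-! ### §7 The `t`-axis and the radial ray: monotonicity of the nearest-neighbour hopping energy (L-8r) -/

/-- **The mean energy is affine in all three couplings** `(t, t', U)`:
`e_{Φ(t_P,t'_P,U_P)}(ω) = e_{Φ(t_A,t'_A,U_A)}(ω) + (t_P − t_A)·e_{Φ(1,0,0)}(ω) + (U_P − U_A)·D(ω) + (t'_P − t'_A)·A(ω)`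
(`meanEnergy_hubbardTTPrime_add` / `_smul` / `_affine`). [cite: BratteliKishimotoRobinson1978, §3] -/
theorem meanEnergy_hubbardTTPrime_affine3 (ω : InfVolFermionState 2) (tA t'A UA tP t'P UP : ℝ) :
    ω.meanEnergy (hubbardTTPrimeFermionInteraction tP t'P UP) 1 =
      ω.meanEnergy (hubbardTTPrimeFermionInteraction tA t'A UA) 1 +
        (tP - tA) * ω.meanEnergy (hubbardTTPrimeFermionInteraction 1 0 0) 1 +
        (UP - UA) * ω.meanEnergy (hubbardTTPrimeFermionInteraction 0 0 1) 1 +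
        (t'P - t'A) * ω.meanEnergy (hubbardTTPrimeFermionInteraction 0 1 0) 1 := by
  have h1 : ω.meanEnergy (hubbardTTPrimeFermionInteraction tP t'P UP) 1 =
      ω.meanEnergy (hubbardTTPrimeFermionInteraction ((tP - tA) + tA) (0 + t'P) (0 + UP)) 1 := by
    rw [sub_add_cancel, zero_add, zero_add]
  rw [h1, ω.meanEnergy_hubbardTTPrime_add (tP - tA) tA 0 t'P 0 UP]
  have h2 : ω.meanEnergy (hubbardTTPrimeFermionInteraction (tP - tA) 0 0) 1 =
      (tP - tA) * ω.meanEnergy (hubbardTTPrimeFermionInteraction 1 0 0) 1 := by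
    have h := ω.meanEnergy_hubbardTTPrime_smul (tP - tA) 1 0 0
    rwa [mul_one, mul_zero] at h
  rw [h2, ω.meanEnergy_hubbardTTPrime_affine tA t'A UA t'P UP]
  ring

/-- **The `t`-axis case**: at fixed `(t', U)`, `t_A < t_P` ⇒ `e_{Φ(1,0,0)}(ωP) ≤ e_{Φ(1,0,0)}(ωA)` (the nn hopping
amplitude `Re⟨T⟩` per site is non-decreasing in `t`). [cite: KomaTasaki1994, §1] -/
theorem nnHopEnergy_anti_of_cross_variational (ωP ωA : InfVolFermionState 2) {tA tP t' U : ℝ}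
    (ht : tA < tP)
    (hP : ωP.meanEnergy (hubbardTTPrimeFermionInteraction tP t' U) 1 ≤
      ωA.meanEnergy (hubbardTTPrimeFermionInteraction tP t' U) 1)
    (hA : ωA.meanEnergy (hubbardTTPrimeFermionInteraction tA t' U) 1 ≤
      ωP.meanEnergy (hubbardTTPrimeFermionInteraction tA t' U) 1) :
    ωP.meanEnergy (hubbardTTPrimeFermionInteraction 1 0 0) 1 ≤
      ωA.meanEnergy (hubbardTTPrimeFermionInteraction 1 0 0) 1 := by
  have h := directional3_le_of_cross_variational ωP ωA tA t' U tP t' U hP hA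
  rw [sub_self, sub_self, zero_mul, zero_mul, add_zero, add_zero] at h
  nlinarith [h, ht]

/-- **Radial monotonicity of the nn-hopping energy for torus-limit ground states at `t = 1`** (TARGET R-9 (c′);
no ground-state scaling lemma needed — the scaling is done on the MEAN-ENERGY side with
`meanEnergy_hubbardTTPrime_smul`): if `ωA`, `ωP` are torus limits of unit sector ground states of the same
density `n` at `A = (1, t'₁, U₁)` and at the radially scaled point `P = (1, c·t'₁, c·U₁)`, `1 < c`, `0 ≤ U₁`,
then `K₁(ωA) ≤ K₁(ωP)` with `K₁ = e_{Φ(1,0,0)} = −Re⟨T⟩` per site: the nn hopping amplitude is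
non-increasing OUTWARD along radial rays (a certified kinetic CEILING `Re⟨T⟩ ≤ c` at the outward point
holds at every inner point of the ray; a kinetic FLOOR at the inner point holds outward).
[cite: KomaTasaki1994, §1] [cite: Griffiths1966, §II] -/
theorem IsTorusLimitOf.nnHopEnergy_radial_mono_of_groundStates (t'₁ : ℝ) {U₁ c : ℝ} (hU₁ : 0 ≤ U₁)
    (hc : 1 < c) {n : ℝ} (hn0 : 0 ≤ n) (hn2 : n < 2)
    {ωA ωP : InfVolFermionState 2} {ψA ψP : ∀ L, Fock (Orb (FermionTorus 2 L))} {LsA LsP : ℕ → ℕ}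
    (hA : ωA.IsTorusLimitOf ψA LsA) (hLsA : Tendsto LsA atTop atTop)
    (hψA : ∀ j, IsGroundStateInSector (hubbardTorusTT' (LsA j) 1 t'₁ U₁) (rectN n (LsA j)) 0 (ψA (LsA j)))
    (h1A : ∀ j, star (ψA (LsA j)) ⬝ᵥ ψA (LsA j) = 1)
    (hP : ωP.IsTorusLimitOf ψP LsP) (hLsP : Tendsto LsP atTop atTop)
    (hψP : ∀ j, IsGroundStateInSector (hubbardTorusTT' (LsP j) 1 (c * t'₁) (c * U₁)) (rectN n (LsP j)) 0
      (ψP (LsP j)))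
    (h1P : ∀ j, star (ψP (LsP j)) ⬝ᵥ ψP (LsP j) = 1) :
    ωA.meanEnergy (hubbardTTPrimeFermionInteraction 1 0 0) 1 ≤
      ωP.meanEnergy (hubbardTTPrimeFermionInteraction 1 0 0) 1 := by
  have hc0 : 0 < c := one_pos.trans hc
  have hcU : 0 ≤ c * U₁ := mul_nonneg hc0.le hU₁
  have hNA : ∀ j, IsNParticle (rectN n (LsA j)) (ψA (LsA j)) := fun j =>
    ((mem_szSector_iff _ _ _).1 (hψA j).1).1
  have hNP : ∀ j, IsNParticle (rectN n (LsP j)) (ψP (LsP j)) := fun j =>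
    ((mem_szSector_iff _ _ _).1 (hψP j).1).1
  -- the two cross-variational inequalities at the t = 1 points P and A
  have hcrossP : ωP.meanEnergy (hubbardTTPrimeFermionInteraction 1 (c * t'₁) (c * U₁)) 1 ≤
      ωA.meanEnergy (hubbardTTPrimeFermionInteraction 1 (c * t'₁) (c * U₁)) 1 := by
    rw [hP.meanEnergy_hubbardTTPrime_eq_energyDensityTT' 1 (c * t'₁) hcU hn0 hn2 hLsP hψP h1P]
    exact hA.energyDensityTT'_le_meanEnergy_hubbardTTPrime 1 (c * t'₁) hcU hn0 hn2 hLsA hNA h1A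
  have hcrossA : ωA.meanEnergy (hubbardTTPrimeFermionInteraction 1 t'₁ U₁) 1 ≤
      ωP.meanEnergy (hubbardTTPrimeFermionInteraction 1 t'₁ U₁) 1 := by
    rw [hA.meanEnergy_hubbardTTPrime_eq_energyDensityTT' 1 t'₁ hU₁ hn0 hn2 hLsA hψA h1A]
    exact hP.energyDensityTT'_le_meanEnergy_hubbardTTPrime 1 t'₁ hU₁ hn0 hn2 hLsP hNP h1P
  -- rescale the inequality at P to the coupling (1/c, t'₁, U₁): Φ(1/c, t'₁, U₁) = (1/c)·Φ(1, c t'₁, c U₁)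
  have hsP := ωP.meanEnergy_hubbardTTPrime_smul c⁻¹ 1 (c * t'₁) (c * U₁)
  have hsA := ωA.meanEnergy_hubbardTTPrime_smul c⁻¹ 1 (c * t'₁) (c * U₁)
  have e1 : c⁻¹ * (c * t'₁) = t'₁ := by rw [← mul_assoc, inv_mul_cancel₀ hc0.ne', one_mul]
  have e2 : c⁻¹ * (c * U₁) = U₁ := by rw [← mul_assoc, inv_mul_cancel₀ hc0.ne', one_mul]
  rw [mul_one, e1, e2] at hsP hsA
  have hP' : ωP.meanEnergy (hubbardTTPrimeFermionInteraction c⁻¹ t'₁ U₁) 1 ≤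
      ωA.meanEnergy (hubbardTTPrimeFermionInteraction c⁻¹ t'₁ U₁) 1 := by
    rw [hsP, hsA]
    exact mul_le_mul_of_nonneg_left hcrossP (inv_pos.2 hc0).le
  have h := directional3_le_of_cross_variational ωP ωA 1 t'₁ U₁ c⁻¹ t'₁ U₁ hP' hcrossA
  rw [sub_self, sub_self, zero_mul, zero_mul, add_zero, add_zero] at h
  have hlt : c⁻¹ - 1 < 0 := by rw [sub_neg]; exact inv_lt_one_of_one_lt₀ hc
  nlinarith [h, hlt]

/-! ### §8 The anchor-chord family: ONE cap and ONE cut with the `U`-dependent multipliers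
`κ = λ = 1/|U − U_a|` — a docc bracket valid at every `U` of a segment at once, and the flat edge under
a tangent cap (crew hubbard-algo planner-p2 FOLD 2 (C2), `AnchorChordBox`; every state) -/

/-- **Upper `U`-chord for the double occupancy, every state.** If a state `ω` obeys the cap
`e_{Φ(t,t',U)}(ω) ≤ u` and the cut `ℓ ≤ e_{Φ(t,t',U_a)}(ω)` at an anchor `U_a < U` (same `t, t'`), then
`D(ω) ≤ (u − ℓ)/(U − U_a)`: the affine identity `e_{Φ(t,t',U)}(ω) = e_{Φ(t,t',U_a)}(ω) + (U − U_a)·D(ω)`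
(`meanEnergy_hubbardTTPrime_affine`), i.e. `capCuts_dual_le` with the single cut and `κ = λ = 1/(U − U_a)`.
No ground-state hypothesis; `u`, `ℓ` arbitrary reals (so `u` may be any cap PLANE evaluated at `U`).
[cite: Bertsekas1999NonlinearProgramming, Prop. 5.1.3] [cite: KomaTasaki1994, §1] -/
theorem docc_le_chord_of_cap_of_cut (ω : InfVolFermionState 2) (t t' : ℝ) {Ua U u ℓ : ℝ} (hUa : Ua < U)
    (hcap : ω.meanEnergy (hubbardTTPrimeFermionInteraction t t' U) 1 ≤ u)
    (hcut : ℓ ≤ ω.meanEnergy (hubbardTTPrimeFermionInteraction t t' Ua) 1) :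
    ω.meanEnergy (hubbardTTPrimeFermionInteraction 0 0 1) 1 ≤ (u - ℓ) / (U - Ua) := by
  have haff := ω.meanEnergy_hubbardTTPrime_affine t t' Ua t' U
  rw [sub_self, zero_mul, add_zero] at haff
  rw [le_div_iff₀ (sub_pos.2 hUa)]
  nlinarith [haff, hcap, hcut]

/-- **Lower `U`-chord for the double occupancy, every state** (anchor ABOVE the query): cap
`e_{Φ(t,t',U)}(ω) ≤ u`, cut `ℓ ≤ e_{Φ(t,t',U_a)}(ω)` with `U < U_a` ⇒ `(ℓ − u)/(U_a − U) ≤ D(ω)`.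
[cite: Bertsekas1999NonlinearProgramming, Prop. 5.1.3] [cite: KomaTasaki1994, §1] -/
theorem chord_le_docc_of_cap_of_cut (ω : InfVolFermionState 2) (t t' : ℝ) {Ua U u ℓ : ℝ} (hUa : U < Ua)
    (hcap : ω.meanEnergy (hubbardTTPrimeFermionInteraction t t' U) 1 ≤ u)
    (hcut : ℓ ≤ ω.meanEnergy (hubbardTTPrimeFermionInteraction t t' Ua) 1) :
    (ℓ - u) / (Ua - U) ≤ ω.meanEnergy (hubbardTTPrimeFermionInteraction 0 0 1) 1 := by
  have haff := ω.meanEnergy_hubbardTTPrime_affine t t' U t' Ua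
  rw [sub_self, zero_mul, add_zero] at haff
  rw [div_le_iff₀ (sub_pos.2 hUa)]
  nlinarith [haff, hcap, hcut]

/-- **The two-sided chord bracket from one cap and two cuts** (anchors `U_a < U < U_b`, same `t, t'`):
`(ℓ_b − u)/(U_b − U) ≤ D(ω) ≤ (u − ℓ_a)/(U − U_a)` for every state obeying the cap at `U` and the cuts at
`U_a`, `U_b`. [cite: Bertsekas1999NonlinearProgramming, Prop. 5.1.3] [cite: KomaTasaki1994, §1] -/
theorem docc_mem_Icc_chord_of_cap_of_cuts (ω : InfVolFermionState 2) (t t' : ℝ) {Ua U Ub u ℓa ℓb : ℝ}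
    (hUa : Ua < U) (hUb : U < Ub)
    (hcap : ω.meanEnergy (hubbardTTPrimeFermionInteraction t t' U) 1 ≤ u)
    (hcuta : ℓa ≤ ω.meanEnergy (hubbardTTPrimeFermionInteraction t t' Ua) 1)
    (hcutb : ℓb ≤ ω.meanEnergy (hubbardTTPrimeFermionInteraction t t' Ub) 1) :
    ω.meanEnergy (hubbardTTPrimeFermionInteraction 0 0 1) 1 ∈
      Set.Icc ((ℓb - u) / (Ub - U)) ((u - ℓa) / (U - Ua)) :=
  ⟨ω.chord_le_docc_of_cap_of_cut t t' hUb hcap hcutb, ω.docc_le_chord_of_cap_of_cut t t' hUa hcap hcuta⟩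

/-- **The chord under a TANGENT cap is constant** (pure arithmetic): with the cap plane through
`(U₀, u₀)` of slope `(u₀ − ℓ)/(U₀ − U_a)` — the chord slope itself — the chord bound at any `U ≠ U_a` equals
the anchor chord: `(u₀ + (U − U₀)·(u₀ − ℓ)/(U₀ − U_a) − ℓ)/(U − U_a) = (u₀ − ℓ)/(U₀ − U_a)`. (This is the
"LP-valued edge": along it the one-cap-one-cut bound does not degrade with `U`.) [folklore] -/
private theorem chord_of_tangentCap {Ua U₀ U u₀ ℓ : ℝ} (hU₀ : U₀ ≠ Ua) (hU : U ≠ Ua) :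
    (u₀ + (U - U₀) * ((u₀ - ℓ) / (U₀ - Ua)) - ℓ) / (U - Ua) = (u₀ - ℓ) / (U₀ - Ua) := by
  have h1 : U₀ - Ua ≠ 0 := sub_ne_zero.2 hU₀
  have h2 : U - Ua ≠ 0 := sub_ne_zero.2 hU
  field_simp
  ring

/-- **The flat edge**: if a state `ω` obeys the TANGENT cap
`e_{Φ(t,t',U)}(ω) ≤ u₀ + (U − U₀)·(u₀ − ℓ)/(U₀ − U_a)` at some `U > U_a` (`U₀ ≠ U_a`) and the cut
`ℓ ≤ e_{Φ(t,t',U_a)}(ω)`, then `D(ω) ≤ (u₀ − ℓ)/(U₀ − U_a)` — the SAME number at every `U` of the ray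
`U > U_a` (the certified docc ceiling transported from `U₀` with the `U`-dependent multipliers
`κ = λ = 1/(U − U_a)` loses nothing under the tangent cap).
[cite: Bertsekas1999NonlinearProgramming, Prop. 5.1.3] [cite: KomaTasaki1994, §1] -/
theorem docc_le_chord_of_tangentCap_of_cut (ω : InfVolFermionState 2) (t t' : ℝ) {Ua U₀ U u₀ ℓ : ℝ}
    (hU₀ : U₀ ≠ Ua) (hUa : Ua < U)
    (hcap : ω.meanEnergy (hubbardTTPrimeFermionInteraction t t' U) 1 ≤
      u₀ + (U - U₀) * ((u₀ - ℓ) / (U₀ - Ua)))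
    (hcut : ℓ ≤ ω.meanEnergy (hubbardTTPrimeFermionInteraction t t' Ua) 1) :
    ω.meanEnergy (hubbardTTPrimeFermionInteraction 0 0 1) 1 ≤ (u₀ - ℓ) / (U₀ - Ua) := by
  have h := ω.docc_le_chord_of_cap_of_cut t t' hUa hcap hcut
  rwa [chord_of_tangentCap hU₀ hUa.ne'] at h

/-- **Lower `U`-chord for torus-limit ground states from the certified energy table** (the mirror of
`re_expect_docc_le_chord_of_groundState`): for a torus limit `ω` of unit sector ground states at
`(t,t',U)` (`U ≥ 0`, `0 ≤ n < 2`), a certified cap `e(t,t',U,n) ≤ u` and a certified cut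
`ℓ ≤ e(t,t',U₀,n)` at an anchor `U₀ > U`: `(ℓ − u)/(U₀ − U) ≤ Re ω(n_{0↑}n_{0↓})`.
[cite: KomaTasaki1994, §1] [cite: Ruelle1969, §3.4] -/
theorem IsTorusLimitOf.chord_le_re_expect_docc_of_groundState (t t' : ℝ) {U : ℝ} (hU : 0 ≤ U) {n : ℝ}
    (hn0 : 0 ≤ n) (hn2 : n < 2)
    {ω : InfVolFermionState 2} {ψ : ∀ L, Fock (Orb (FermionTorus 2 L))} {Ls : ℕ → ℕ}
    (h : ω.IsTorusLimitOf ψ Ls) (hLs : Tendsto Ls atTop atTop)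
    (hψ : ∀ j, IsGroundStateInSector (hubbardTorusTT' (Ls j) t t' U) (rectN n (Ls j)) 0 (ψ (Ls j)))
    (h1 : ∀ j, star (ψ (Ls j)) ⬝ᵥ ψ (Ls j) = 1)
    {u : ℝ} (hu : energyDensityTT' t t' U n ≤ u) {U₀ ℓ : ℝ} (hUU₀ : U < U₀)
    (hℓ : ℓ ≤ energyDensityTT' t t' U₀ n) :
    (ℓ - u) / (U₀ - U) ≤
      (ω.expect ({0} : Finset (Site 2))
        (nAt 0 (Finset.mem_singleton_self 0) 0 * nAt 0 (Finset.mem_singleton_self 0) 1)).re := by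
  have hU₀ : 0 ≤ U₀ := hU.trans hUU₀.le
  have hN : ∀ j, IsNParticle (rectN n (Ls j)) (ψ (Ls j)) := fun j =>
    ((mem_szSector_iff _ _ _).1 (hψ j).1).1
  have hcap : ω.meanEnergy (hubbardTTPrimeFermionInteraction t t' U) 1 ≤ u := by
    rw [h.meanEnergy_hubbardTTPrime_eq_energyDensityTT' t t' hU hn0 hn2 hLs hψ h1]; exact hu
  have hcut : ℓ ≤ ω.meanEnergy (hubbardTTPrimeFermionInteraction t t' U₀) 1 :=
    hℓ.trans (h.energyDensityTT'_le_meanEnergy_hubbardTTPrime t t' hU₀ hn0 hn2 hLs hN h1)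
  rw [← h.meanEnergy_onSite_eq_re_expect_docc hLs]
  exact ω.chord_le_docc_of_cap_of_cut t t' hUU₀ hcap hcut

/-- **The flat edge for torus-limit ground states**: with a certified cut `ℓ ≤ e(t,t',U_a,n)`
(`0 ≤ U_a`), an anchor `U₀ ≠ U_a` carrying the cap value `u₀`, and the TANGENT cap
`e(t,t',U,n) ≤ u₀ + (U − U₀)·(u₀ − ℓ)/(U₀ − U_a)` at the query `U > U_a` (e.g. the transported cap
`energyDensityTT'_le_of_forall_isTorusLimitOf_docc` when the certified docc ceiling at `U₀` IS the chord
`(u₀ − ℓ)/(U₀ − U_a)`), every torus-limit sector ground state `ω` at `(t,t',U)` has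
`Re ω(n_{0↑}n_{0↓}) ≤ (u₀ − ℓ)/(U₀ − U_a)`. [cite: KomaTasaki1994, §1] [cite: Ruelle1969, §3.4] -/
theorem IsTorusLimitOf.re_expect_docc_le_chord_of_tangentCap_of_groundState (t t' : ℝ) {U : ℝ}
    (hU : 0 ≤ U) {n : ℝ} (hn0 : 0 ≤ n) (hn2 : n < 2)
    {ω : InfVolFermionState 2} {ψ : ∀ L, Fock (Orb (FermionTorus 2 L))} {Ls : ℕ → ℕ}
    (h : ω.IsTorusLimitOf ψ Ls) (hLs : Tendsto Ls atTop atTop)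
    (hψ : ∀ j, IsGroundStateInSector (hubbardTorusTT' (Ls j) t t' U) (rectN n (Ls j)) 0 (ψ (Ls j)))
    (h1 : ∀ j, star (ψ (Ls j)) ⬝ᵥ ψ (Ls j) = 1)
    {Ua U₀ u₀ ℓ : ℝ} (hUa0 : 0 ≤ Ua) (hUa : Ua < U) (hU₀ : U₀ ≠ Ua)
    (hu : energyDensityTT' t t' U n ≤ u₀ + (U - U₀) * ((u₀ - ℓ) / (U₀ - Ua)))
    (hℓ : ℓ ≤ energyDensityTT' t t' Ua n) :
    (ω.expect ({0} : Finset (Site 2))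
        (nAt 0 (Finset.mem_singleton_self 0) 0 * nAt 0 (Finset.mem_singleton_self 0) 1)).re ≤
      (u₀ - ℓ) / (U₀ - Ua) := by
  have key := h.re_expect_docc_le_chord_of_groundState t t' hU hn0 hn2 hLs hψ h1 hu hUa0 hUa hℓ
  rwa [chord_of_tangentCap hU₀ hUa.ne'] at key

/-! ### §9 The 2-D cell: a cap at `(t, t'_P, U)` and a cut at an anchor `(t, t'_a, U_a)` with a
DIFFERENT diagonal hopping — the `U`-chord with the conjugate-word correction `(t'_P − t'_a)·K₂`
(crew hubbard-algo planner-p2 TARGET §15.10 row (A), "2-D cell closed form", checked sketch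
`AnchorChordBox.lean` `docc_le_chord_of_cap_of_anchor_2d`; every state) -/

/-- **2-D anchor chord, upper edge, every state.** If a state `ω` obeys the cap
`e_{Φ(t,t'_P,U)}(ω) ≤ u`, the cut `ℓ ≤ e_{Φ(t,t'_a,U_a)}(ω)` at an anchor with `U_a < U` (any `t'_a`), and
the conjugate diagonal-hopping word is certified in range, `|(t'_P − t'_a)·K₂(ω)| ≤ R`, then
`D(ω) ≤ (u − ℓ + R)/(U − U_a)`: the affine identity
`e_{Φ(t,t'_P,U)}(ω) = e_{Φ(t,t'_a,U_a)}(ω) + (U − U_a)·D(ω) + (t'_P − t'_a)·K₂(ω)`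
(`meanEnergy_hubbardTTPrime_affine`), i.e. `capCuts_dual_le` with the single cut, `κ = λ = 1/(U − U_a)`,
and the leftover `K₂`-coefficient `(t'_a − t'_P)/(U − U_a)` priced by the range row. With `t'_a = t'_P`
and `R = 0` this is §8's `docc_le_chord_of_cap_of_cut`. `u`, `ℓ`, `R` arbitrary reals, so the bound holds
at every point of a `(U, t')` cell at once with any cap PLANE `u(U,t')` and any range table `R(t')`.
[cite: Bertsekas1999NonlinearProgramming, Prop. 5.1.3] [cite: KomaTasaki1994, §1] -/
theorem docc_le_chord_of_cap_of_cut_of_abs_diagHop_le (ω : InfVolFermionState 2) (t : ℝ)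
    {t'a t'P Ua U u ℓ R : ℝ} (hUa : Ua < U)
    (hcap : ω.meanEnergy (hubbardTTPrimeFermionInteraction t t'P U) 1 ≤ u)
    (hcut : ℓ ≤ ω.meanEnergy (hubbardTTPrimeFermionInteraction t t'a Ua) 1)
    (hR : |(t'P - t'a) * ω.meanEnergy (hubbardTTPrimeFermionInteraction 0 1 0) 1| ≤ R) :
    ω.meanEnergy (hubbardTTPrimeFermionInteraction 0 0 1) 1 ≤ (u - ℓ + R) / (U - Ua) := by
  have haff := ω.meanEnergy_hubbardTTPrime_affine t t'a Ua t'P U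
  have h3 := (abs_le.1 hR).1
  rw [le_div_iff₀ (sub_pos.2 hUa)]
  nlinarith [haff, hcap, hcut, h3]

/-- **2-D anchor chord, lower edge, every state** (anchor ABOVE the query in `U`): cap
`e_{Φ(t,t'_P,U)}(ω) ≤ u`, cut `ℓ ≤ e_{Φ(t,t'_a,U_a)}(ω)` with `U < U_a`, range `|(t'_P − t'_a)·K₂(ω)| ≤ R`
⇒ `(ℓ − u − R)/(U_a − U) ≤ D(ω)`.
[cite: Bertsekas1999NonlinearProgramming, Prop. 5.1.3] [cite: KomaTasaki1994, §1] -/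
theorem chord_le_docc_of_cap_of_cut_of_abs_diagHop_le (ω : InfVolFermionState 2) (t : ℝ)
    {t'a t'P Ua U u ℓ R : ℝ} (hUa : U < Ua)
    (hcap : ω.meanEnergy (hubbardTTPrimeFermionInteraction t t'P U) 1 ≤ u)
    (hcut : ℓ ≤ ω.meanEnergy (hubbardTTPrimeFermionInteraction t t'a Ua) 1)
    (hR : |(t'P - t'a) * ω.meanEnergy (hubbardTTPrimeFermionInteraction 0 1 0) 1| ≤ R) :
    (ℓ - u - R) / (Ua - U) ≤ ω.meanEnergy (hubbardTTPrimeFermionInteraction 0 0 1) 1 := by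
  have haff := ω.meanEnergy_hubbardTTPrime_affine t t'a Ua t'P U
  have h3 := (abs_le.1 hR).1
  rw [div_le_iff₀ (sub_pos.2 hUa)]
  nlinarith [haff, hcap, hcut, h3]

/-- **Feeding the range row from a `K₂` table**: if `|K₂(ω)| ≤ K` (e.g. the kinematic row
`IsTorusLimitOf.abs_meanEnergy_diagHop_le`, `K = 16/π²`, or a certified bracket of the diagonal-hopping
word), then `|(t'_P − t'_a)·K₂(ω)| ≤ |t'_P − t'_a|·K`, so the 2-D chord reads
`D(ω) ≤ (u − ℓ + |t'_P − t'_a|·K)/(U − U_a)` — the explicit interior bound on a `(U, t')` cell from ONE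
anchor cut, ONE cap plane and the `K₂` range, no moment matrix.
[cite: Bertsekas1999NonlinearProgramming, Prop. 5.1.3] [cite: KomaTasaki1994, §1] -/
theorem docc_le_chord_of_cap_of_cut_of_abs_K₂_le (ω : InfVolFermionState 2) (t : ℝ)
    {t'a t'P Ua U u ℓ K : ℝ} (hUa : Ua < U)
    (hcap : ω.meanEnergy (hubbardTTPrimeFermionInteraction t t'P U) 1 ≤ u)
    (hcut : ℓ ≤ ω.meanEnergy (hubbardTTPrimeFermionInteraction t t'a Ua) 1)
    (hK : |ω.meanEnergy (hubbardTTPrimeFermionInteraction 0 1 0) 1| ≤ K) :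
    ω.meanEnergy (hubbardTTPrimeFermionInteraction 0 0 1) 1 ≤ (u - ℓ + |t'P - t'a| * K) / (U - Ua) :=
  ω.docc_le_chord_of_cap_of_cut_of_abs_diagHop_le t hUa hcap hcut
    (by rw [abs_mul]; exact mul_le_mul_of_nonneg_left hK (abs_nonneg _))

/-- Lower twin of `docc_le_chord_of_cap_of_cut_of_abs_K₂_le` (anchor above in `U`):
`(ℓ − u − |t'_P − t'_a|·K)/(U_a − U) ≤ D(ω)`.
[cite: Bertsekas1999NonlinearProgramming, Prop. 5.1.3] [cite: KomaTasaki1994, §1] -/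
theorem chord_le_docc_of_cap_of_cut_of_abs_K₂_le (ω : InfVolFermionState 2) (t : ℝ)
    {t'a t'P Ua U u ℓ K : ℝ} (hUa : U < Ua)
    (hcap : ω.meanEnergy (hubbardTTPrimeFermionInteraction t t'P U) 1 ≤ u)
    (hcut : ℓ ≤ ω.meanEnergy (hubbardTTPrimeFermionInteraction t t'a Ua) 1)
    (hK : |ω.meanEnergy (hubbardTTPrimeFermionInteraction 0 1 0) 1| ≤ K) :
    (ℓ - u - |t'P - t'a| * K) / (Ua - U) ≤ ω.meanEnergy (hubbardTTPrimeFermionInteraction 0 0 1) 1 :=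
  ω.chord_le_docc_of_cap_of_cut_of_abs_diagHop_le t hUa hcap hcut
    (by rw [abs_mul]; exact mul_le_mul_of_nonneg_left hK (abs_nonneg _))

/-- **2-D cell row for torus-limit ground states from the certified energy table.** For a torus limit
`ω` of unit sector ground states at `(t, t'_P, U)` (`U ≥ 0`, `0 ≤ n < 2`), a certified cap
`e(t,t'_P,U,n) ≤ u`, a certified cut `ℓ ≤ e(t,t'_a,U_a,n)` at an anchor `0 ≤ U_a < U` with ANY diagonal
hopping `t'_a`, and a range `|K₂(ω)| ≤ K` of the unit diagonal-hopping energy per site: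
`Re ω(n_{0↑}n_{0↓}) ≤ (u − ℓ + |t'_P − t'_a|·K)/(U − U_a)`.
[cite: KomaTasaki1994, §1] [cite: Ruelle1969, §3.4] -/
theorem IsTorusLimitOf.re_expect_docc_le_chord_of_cut_of_abs_K₂_le_of_groundState (t t'P : ℝ) {U : ℝ}
    (hU : 0 ≤ U) {n : ℝ} (hn0 : 0 ≤ n) (hn2 : n < 2)
    {ω : InfVolFermionState 2} {ψ : ∀ L, Fock (Orb (FermionTorus 2 L))} {Ls : ℕ → ℕ}
    (h : ω.IsTorusLimitOf ψ Ls) (hLs : Tendsto Ls atTop atTop)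
    (hψ : ∀ j, IsGroundStateInSector (hubbardTorusTT' (Ls j) t t'P U) (rectN n (Ls j)) 0 (ψ (Ls j)))
    (h1 : ∀ j, star (ψ (Ls j)) ⬝ᵥ ψ (Ls j) = 1)
    {u : ℝ} (hu : energyDensityTT' t t'P U n ≤ u) {t'a Ua ℓ : ℝ} (hUa0 : 0 ≤ Ua) (hUa : Ua < U)
    (hℓ : ℓ ≤ energyDensityTT' t t'a Ua n)
    {K : ℝ} (hK : |ω.meanEnergy (hubbardTTPrimeFermionInteraction 0 1 0) 1| ≤ K) :
    (ω.expect ({0} : Finset (Site 2))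
        (nAt 0 (Finset.mem_singleton_self 0) 0 * nAt 0 (Finset.mem_singleton_self 0) 1)).re ≤
      (u - ℓ + |t'P - t'a| * K) / (U - Ua) := by
  have hN : ∀ j, IsNParticle (rectN n (Ls j)) (ψ (Ls j)) := fun j =>
    ((mem_szSector_iff _ _ _).1 (hψ j).1).1
  have hcap : ω.meanEnergy (hubbardTTPrimeFermionInteraction t t'P U) 1 ≤ u := by
    rw [h.meanEnergy_hubbardTTPrime_eq_energyDensityTT' t t'P hU hn0 hn2 hLs hψ h1]; exact hu
  have hcut : ℓ ≤ ω.meanEnergy (hubbardTTPrimeFermionInteraction t t'a Ua) 1 :=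
    hℓ.trans (h.energyDensityTT'_le_meanEnergy_hubbardTTPrime t t'a hUa0 hn0 hn2 hLs hN h1)
  rw [← h.meanEnergy_onSite_eq_re_expect_docc hLs]
  exact ω.docc_le_chord_of_cap_of_cut_of_abs_K₂_le t hUa hcap hcut hK

/-- Lower twin for torus-limit ground states (anchor ABOVE in `U`, any `t'_a`):
`(ℓ − u − |t'_P − t'_a|·K)/(U_a − U) ≤ Re ω(n_{0↑}n_{0↓})`. [cite: KomaTasaki1994, §1] [cite: Ruelle1969, §3.4] -/
theorem IsTorusLimitOf.chord_le_re_expect_docc_of_cut_of_abs_K₂_le_of_groundState (t t'P : ℝ) {U : ℝ}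
    (hU : 0 ≤ U) {n : ℝ} (hn0 : 0 ≤ n) (hn2 : n < 2)
    {ω : InfVolFermionState 2} {ψ : ∀ L, Fock (Orb (FermionTorus 2 L))} {Ls : ℕ → ℕ}
    (h : ω.IsTorusLimitOf ψ Ls) (hLs : Tendsto Ls atTop atTop)
    (hψ : ∀ j, IsGroundStateInSector (hubbardTorusTT' (Ls j) t t'P U) (rectN n (Ls j)) 0 (ψ (Ls j)))
    (h1 : ∀ j, star (ψ (Ls j)) ⬝ᵥ ψ (Ls j) = 1)
    {u : ℝ} (hu : energyDensityTT' t t'P U n ≤ u) {t'a Ua ℓ : ℝ} (hUa : U < Ua)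
    (hℓ : ℓ ≤ energyDensityTT' t t'a Ua n)
    {K : ℝ} (hK : |ω.meanEnergy (hubbardTTPrimeFermionInteraction 0 1 0) 1| ≤ K) :
    (ℓ - u - |t'P - t'a| * K) / (Ua - U) ≤
      (ω.expect ({0} : Finset (Site 2))
        (nAt 0 (Finset.mem_singleton_self 0) 0 * nAt 0 (Finset.mem_singleton_self 0) 1)).re := by
  have hUa0 : 0 ≤ Ua := hU.trans hUa.le
  have hN : ∀ j, IsNParticle (rectN n (Ls j)) (ψ (Ls j)) := fun j =>
    ((mem_szSector_iff _ _ _).1 (hψ j).1).1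
  have hcap : ω.meanEnergy (hubbardTTPrimeFermionInteraction t t'P U) 1 ≤ u := by
    rw [h.meanEnergy_hubbardTTPrime_eq_energyDensityTT' t t'P hU hn0 hn2 hLs hψ h1]; exact hu
  have hcut : ℓ ≤ ω.meanEnergy (hubbardTTPrimeFermionInteraction t t'a Ua) 1 :=
    hℓ.trans (h.energyDensityTT'_le_meanEnergy_hubbardTTPrime t t'a hUa0 hn0 hn2 hLs hN h1)
  rw [← h.meanEnergy_onSite_eq_re_expect_docc hLs]
  exact ω.chord_le_docc_of_cap_of_cut_of_abs_K₂_le t hUa hcap hcut hK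

end InfVolFermionState

end Literature.MathematicalPhysics.QuantumLattice
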